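import Summits.QuantumFields.BalabanUV.Beta.EriceRemainderEnclosureHistoryAutonomyComparisonNonlinearMarkovPrep
import Summits.QuantumFields.BalabanUV.Beta.EriceRemainderEnclosureHistoryAutonomyComparisonNonlinearBaseDefect
import Summits.QuantumFields.BalabanUV.Beta.EriceRemainderEnclosureHistoryAutonomyComparisonNonlinearGaugeDefect

/-!
# EriceRemainderEnclosureHistoryAutonomyComparisonNonlinearMarkov — (E122c) **COMPARISON AT ANY SIZE WITH A SMALL MARKOV RIDER.**  `B u = β₀ + Σ_{k<K} L_k·u_k` (`β₀ > 0`,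
# `L ≥ 0`; the newest-entry = MARKOV weight `L_0 ≥ 0` ALLOWED; profile, range `K`, sizes, loads ARBITRARY); `B′ ≥ B` on the box with a modulus `M′`, the EXCESS
# `E = B′ − B` ISOTONE and of modulus `ME` along ordered pairs, with **`(L_0 + ME)·γ ≤ β₀∕5`** (the size of the excess free).  Then: (**`steps_nonneg_gauge_markov`**)
# along every base orbit `X_m ≥ 0` and `G_m = X_m·h_m²` is non-increasing; (**`effective_le_markov`**) `B(S y) ≤ B′(S′y)` at every pin; (**`le_of_small_modulus_excess_markov`**,
# family-free) ANY box solutions `h`, `h′` of `B`, `B′` from one pin satisfy `h′ ≤ h` at EVERY scale.  This is (E119d) `le_of_small_modulus_excess` WITHOUT `L_0 = 0`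
# (`HOME/b2b-balaban-beta-d4-p2/g98/README.md` §4 (2), the cheap case), and the first theorem of the column assembled ENTIRELY from the generic pieces: the defect
# (E122b) `conf_incr_ge_markov` (`θ_k = F(n+k+1) + (L_0 + ME)·h_{n+k+1}³∕2`), its price (E119b) `defect_mod_le` (with `ME ↦ L_0 + ME`), the generic step (E121d)
# `gauge_step_of_defect`, the generic base (E122a) `base_gauge_of_defect` (`ξ_k ≤ (β₀∕10)·h_{n+1}²`), the deep region (E118c) `exists_base_depth` + (E49j)(1).

Cell `pub-balaban`, β-function sub-cell, BINDER row D4 «RemainderConst leaves for Bałaban's split» (`HOME/BINDER-OWNERS.md`; owner lineage `b2b-balaban-beta-an4`;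
this file by co-owner #2 lineage `b2b-balaban-beta-d4-p2`, generation 99), β-FLOW TEAM duty (1), FREEZE (0) honoured (def-free; imports (E122a∕b), (E121d); uses (E118a)
`affine_facts`, (E118c) `exists_base_depth`, (E119b) `excess_facts` ∕ `cmp_of_steps_nonneg` ∕ `excess_orbit_antitone` ∕ `defect_mod_le`, (E121d) `gauge_step_of_defect`,
(E122a) `base_gauge_of_defect`, (E122b) `conf_incr_ge_markov`, (E49j) `effective_le_of_small_pin`, (E49k) `family_le_of_orbit`, (E39) `exists_memFlow_zm`, (E43b)
`memFlow_unique_of_monotone_zm`, (E48a) `family_mem` ∕ `family_zero` BY NAME; §3 is (E119d)'s re-run — nothing else restated).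

HONEST FRAMING (page 1, verbatim and binding).  *"Discharging BetaPertH makes Bałaban's UV stability UNCONDITIONAL — a real constructive-QFT result; it is
NOT the continuum limit and NOT the Clay problem."*  THIS FILE DISCHARGES NOTHING OF THE KIND.  Elementary real analysis about ABSTRACT functionals on a box
]0,γ]^ℕ with displayed floors, moduli, profiles and signs — hypotheses of a census, not facts; the form, signs, ages and moments of Bałaban's (1.22) limit
functional are NOT PRINTED ([I] p. 298; GAPS G-t4-U2-1∕-2) and NOT asserted.  Row D4 class UNCHANGED (critical-path width 0; instance 0∕1; D4 DISCHARGE NO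
DATE).  HONEST DEPENDENCY: continuum YM on T⁴ ⇐ BetaPertH ∧ nine spine estimates (0/9 proved); BetaPertH ⇐ (D1) ∧ (D4) ∧ CAP+tail; G-an2-4 gates asym, D1
and NE2/3/4.  NOT CLAIMED: an ARBITRARY Markov weight (only `(L_0 + ME)·γ ≤ β₀∕5`), anything printed — NOT B12 Thm 2, NOT BetaPertH, NOT continuum, NOT Clay.

WHAT IS PROVED ([folklore]; 0 `def`, 0 sorry).  §1 **`gauge_step_markov`**, `base_gauge_markov`.  §2 **`steps_nonneg_gauge_markov`**.  §3 **`effective_le_markov`**,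
**`le_of_small_modulus_excess_markov`**.
-/

noncomputable section
open Finset Set

namespace Summit.QuantumFields.BalabanUV.Beta.EriceRemainderEnclosureHistoryAutonomyComparisonNonlinearMarkov

open Literature.MathematicalPhysics.QuantumFieldTheory.Balaban1983to89
open Literature.MathematicalPhysics.QuantumFieldTheory.Balaban1983to89.T4BetaStationary
open Literature.MathematicalPhysics.QuantumFieldTheory.Balaban1983to89.T4BetaFlowWellPosed
open Summit.QuantumFields.BalabanUV.Beta.EriceRemainderEnclosureHistoryAutonomyOrder (family_mem family_zero strictAnti_of_memFlow)
open Summit.QuantumFields.BalabanUV.Beta.EriceRemainderEnclosureHistoryAutonomyComparisonExcess (effective_le_of_small_pin)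
open Summit.QuantumFields.BalabanUV.Beta.EriceRemainderEnclosureHistoryAutonomyComparisonIsotoneExcess (family_le_of_orbit)
open Summit.QuantumFields.BalabanUV.Beta.EriceRemainderEnclosureHistoryAutonomyExistence (exists_memFlow_zm)
open Summit.QuantumFields.BalabanUV.Beta.EriceRemainderEnclosureHistoryAutonomyMonotoneGeneral (memFlow_unique_of_monotone_zm)
open Summit.QuantumFields.BalabanUV.Beta.EriceRemainderEnclosureHistoryAutonomyComparisonNonlinearRowPrep (affine_facts)
open Summit.QuantumFields.BalabanUV.Beta.EriceRemainderEnclosureHistoryAutonomyComparisonNonlinearLevelGaugePrep (exists_base_depth)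
open Summit.QuantumFields.BalabanUV.Beta.EriceRemainderEnclosureHistoryAutonomyComparisonNonlinearModulusPrep
  (excess_facts cmp_of_steps_nonneg excess_orbit_antitone defect_mod_le)
open Summit.QuantumFields.BalabanUV.Beta.EriceRemainderEnclosureHistoryAutonomyComparisonNonlinearGaugeDefect (gauge_step_of_defect)
open Summit.QuantumFields.BalabanUV.Beta.EriceRemainderEnclosureHistoryAutonomyComparisonNonlinearBaseDefect (base_gauge_of_defect)
open Summit.QuantumFields.BalabanUV.Beta.EriceRemainderEnclosureHistoryAutonomyComparisonNonlinearMarkovPrep (conf_incr_ge_markov)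

variable {B B' : (ℕ → ℝ) → ℝ} {γ β₀ M' ME : ℝ} {L : ℕ → ℝ} {K : ℕ} {S S' : ℝ → ℕ → ℝ}

/-! ## §1 The step and the base of the row induction, as instances -/

set_option maxHeartbeats 800000 in
/-- **THE STEP OF THE ROW INDUCTION WITH A SMALL MARKOV RIDER** (`(L_0 + ME)·γ ≤ β₀∕5`): if `X_m ≥ 0` and `G_{m+1} ≤ G_m` for `m ≥ n+1` then `G_{n+1} + (e_n − e_{n+1})·h_n² ≤ G_n`
((E121d) `gauge_step_of_defect` with (E122b) `conf_incr_ge_markov` priced by (E119b) `defect_mod_le`). [folklore] -/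
theorem gauge_step_markov (hBaff : ∀ u, SeqBox γ u → B u = β₀ + ∑ k ∈ range K, L k * u k) (hL : ∀ k, 0 ≤ L k) (hβ : 0 < β₀)
    (hB' : ∀ u u' : ℕ → ℝ, SeqBox γ u → SeqBox γ u' → ∀ D : ℝ, (∀ j, |u j - u' j| ≤ D) → |B' u - B' u'| ≤ M' * D) (hM' : 0 ≤ M')
    (hexc : ∀ u, SeqBox γ u → B u ≤ B' u)
    (hDmono : ∀ u v : ℕ → ℝ, SeqBox γ u → SeqBox γ v → (∀ j, u j ≤ v j) → B' u - B u ≤ B' v - B v)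
    (hEmod : ∀ u u' : ℕ → ℝ, SeqBox γ u → SeqBox γ u' → (∀ j, u' j ≤ u j) → ∀ D : ℝ, 0 ≤ D → (∀ j, u j - u' j ≤ D) →
      (B' u - B u) - (B' u' - B u') ≤ ME * D) (hME : 0 ≤ ME) (hLMγ : (L 0 + ME) * γ ≤ β₀ / 5)
    (hS : ∀ p, 0 < p → p ≤ γ → SeqBox γ (S p) ∧ MemFlow B p (S p))
    (huniq : ∀ p, 0 < p → p ≤ γ → ∀ u u' : ℕ → ℝ, SeqBox γ u → SeqBox γ u' → MemFlow B p u → MemFlow B p u' → u = u')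
    (hS' : ∀ p, 0 < p → p ≤ γ → SeqBox γ (S' p) ∧ MemFlow B' p (S' p))
    (huniq' : ∀ p, 0 < p → p ≤ γ → ∀ u u' : ℕ → ℝ, SeqBox γ u → SeqBox γ u' → MemFlow B' p u → MemFlow B' p u' → u = u')
    {y : ℝ} (hy : 0 < y) (hyγ : y ≤ γ) (n : ℕ)
    (hX : ∀ m, n + 1 ≤ m → 0 ≤ B' (S' (S y m)) - B (S (S y m)))
    (hg : ∀ m, n + 1 ≤ m → (B' (S' (S y (m + 1))) - B (S (S y (m + 1)))) * S y (m + 1) ^ 2 ≤ (B' (S' (S y m)) - B (S (S y m))) * S y m ^ 2) :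
    (B' (S' (S y (n + 1))) - B (S (S y (n + 1)))) * S y (n + 1) ^ 2
        + ((B' (S' (S y n)) - B (S' (S y n))) - (B' (S' (S y (n + 1))) - B (S' (S y (n + 1))))) * S y n ^ 2
      ≤ (B' (S' (S y n)) - B (S (S y n))) * S y n ^ 2 := by
  obtain ⟨hmono', hlo'⟩ := excess_facts hBaff hL hβ hexc hDmono
  obtain ⟨hmono, hlo, _, _⟩ := affine_facts hBaff hL hβ
  have hh := (hS y hy hyγ).1
  have hf := (hS y hy hyγ).2
  have hpos : ∀ j, 0 < S y j := fun j => (hh j).1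
  have hLM0 : 0 ≤ L 0 + ME := add_nonneg (hL 0) hME
  have hcmp := cmp_of_steps_nonneg hBaff hL hβ hB' hM' hexc hDmono hS huniq hS' huniq' hy hyγ n hX
  -- the defect data
  set ξ : ℕ → ℝ := fun k => (L 0 + ME) * S y (n + k + 1) ^ 3 / 2 with hξ_def
  set θ : ℕ → ℝ := fun k => ∑ q ∈ Ico 1 K, L q * S y (n + k + 1 + q) ^ 3 / 2 + ξ k with hθ_def
  have hθ0 : ∀ k, 0 ≤ θ k := fun k => by
    have h1 : 0 ≤ ∑ q ∈ Ico 1 K, L q * S y (n + k + 1 + q) ^ 3 / 2 :=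
      sum_nonneg fun q _ => by have := hL q; have := hpos (n + k + 1 + q); positivity
    have h2 : 0 ≤ ξ k := by have := hpos (n + k + 1); positivity
    simp only [hθ_def]; linarith
  have hdef : ∀ j, j + 1 < K → (1 / S' (S y (n + 1)) j ^ 2 - 1 / S y (n + 1 + j) ^ 2)
      - (1 / S' (S y (n + 1)) (j + 1) ^ 2 - 1 / S y (n + 1 + j + 1) ^ 2)
      ≤ θ (j + 1) * (1 / S' (S y (n + 1)) j ^ 2 - 1 / S y (n + 1 + j) ^ 2) := by
    intro j _
    have h := conf_incr_ge_markov hBaff hL hmono' hβ hB' hM' hlo' hEmod hME hS huniq hS' huniq' hy hyγ (n + 1) j (hcmp (n + 1) (by omega))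
      (hcmp (n + 1 + 1 + j) (by omega)) (hX (n + 1 + 1 + j) (by omega))
    rw [show n + 1 + 1 + j = n + (j + 1) + 1 by ring] at h
    exact h
  have hθle : ∀ k, 2 ≤ k → k < K → θ k ≤ ∑ q ∈ Ico 1 K, L q * S y (n + k + 1 + q) ^ 3 / 2 + ξ k := fun k _ _ => le_rfl
  have hprice : ∀ k, 2 ≤ k → k < K → ∀ W : ℝ, 0 ≤ W →
      W ≤ (B' (S' (S y (n + 1))) - B (S (S y (n + 1)))) * S y (n + 1) ^ 2 * ∑ l ∈ Ico 1 k, 1 / S y (n + 1 + l) ^ 2 →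
      L k * S y (n + 1 + k) ^ 3 / 2 * ξ k * W ≤ 1 / 20 * (L k * S y (n + 1 + k) * S y (n + 1) ^ 2 * (B' (S' (S y (n + 1))) - B (S (S y (n + 1))))) := by
    intro k hk2 _ W hW0 hW
    exact defect_mod_le (B := B) (L := L) hL hβ hlo hh hf hLM0 hLMγ n (by omega) (hX (n + 1) le_rfl) hW0 hW
  exact gauge_step_of_defect hBaff hL hβ hB' hM' hexc hDmono hS huniq hS' huniq' hy hyγ n hX hg hθ0 hdef hθle hprice

set_option maxHeartbeats 800000 in
/-- **THE BASE OF THE ROW INDUCTION WITH A SMALL MARKOV RIDER**: in the deep region (`u_n ≤ 1∕(5(K+1))`), with configurations comparing from every pin `h_m`, `m ≥ n`, and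
`X_m ≥ 0` for `m ≥ n+1`, `G_{n+1} + (e_n − e_{n+1})·h_n² ≤ G_n` ((E122a) `base_gauge_of_defect`: the extra `(L_0 + ME)·h³∕2 ≤ (β₀∕10)·h_{n+1}²`). [folklore] -/
theorem base_gauge_markov (hBaff : ∀ u, SeqBox γ u → B u = β₀ + ∑ k ∈ range K, L k * u k) (hL : ∀ k, 0 ≤ L k) (hβ : 0 < β₀)
    (hB' : ∀ u u' : ℕ → ℝ, SeqBox γ u → SeqBox γ u' → ∀ D : ℝ, (∀ j, |u j - u' j| ≤ D) → |B' u - B' u'| ≤ M' * D) (hM' : 0 ≤ M')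
    (hexc : ∀ u, SeqBox γ u → B u ≤ B' u)
    (hDmono : ∀ u v : ℕ → ℝ, SeqBox γ u → SeqBox γ v → (∀ j, u j ≤ v j) → B' u - B u ≤ B' v - B v)
    (hEmod : ∀ u u' : ℕ → ℝ, SeqBox γ u → SeqBox γ u' → (∀ j, u' j ≤ u j) → ∀ D : ℝ, 0 ≤ D → (∀ j, u j - u' j ≤ D) →
      (B' u - B u) - (B' u' - B u') ≤ ME * D) (hME : 0 ≤ ME) (hLMγ : (L 0 + ME) * γ ≤ β₀ / 5)
    (hS : ∀ p, 0 < p → p ≤ γ → SeqBox γ (S p) ∧ MemFlow B p (S p))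
    (huniq : ∀ p, 0 < p → p ≤ γ → ∀ u u' : ℕ → ℝ, SeqBox γ u → SeqBox γ u' → MemFlow B p u → MemFlow B p u' → u = u')
    (hS' : ∀ p, 0 < p → p ≤ γ → SeqBox γ (S' p) ∧ MemFlow B' p (S' p))
    (huniq' : ∀ p, 0 < p → p ≤ γ → ∀ u u' : ℕ → ℝ, SeqBox γ u → SeqBox γ u' → MemFlow B' p u → MemFlow B' p u' → u = u')
    {y : ℝ} (hy : 0 < y) (hyγ : y ≤ γ) (n : ℕ)
    (hu : (1 / S y (n + 1) ^ 2 - 1 / S y n ^ 2) * S y (n + 1) ^ 2 ≤ 1 / (5 * ((K : ℝ) + 1)))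
    (hcmp : ∀ m, n ≤ m → ∀ j, S' (S y m) j ≤ S y (m + j)) (hX : ∀ m, n + 1 ≤ m → 0 ≤ B' (S' (S y m)) - B (S (S y m))) :
    (B' (S' (S y (n + 1))) - B (S (S y (n + 1)))) * S y (n + 1) ^ 2
        + ((B' (S' (S y n)) - B (S' (S y n))) - (B' (S' (S y (n + 1))) - B (S' (S y (n + 1))))) * S y n ^ 2
      ≤ (B' (S' (S y n)) - B (S (S y n))) * S y n ^ 2 := by
  obtain ⟨hmono', hlo'⟩ := excess_facts hBaff hL hβ hexc hDmono
  obtain ⟨hmono, hlo, _, _⟩ := affine_facts hBaff hL hβ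
  have hh := (hS y hy hyγ).1
  have hpos : ∀ j, 0 < S y j := fun j => (hh j).1
  have hanti := (strictAnti_of_memFlow hβ hlo hh (hS y hy hyγ).2).antitone
  have hLM0 : 0 ≤ L 0 + ME := add_nonneg (hL 0) hME
  set ξ : ℕ → ℝ := fun k => (L 0 + ME) * S y (n + k + 1) ^ 3 / 2 with hξ_def
  set θ : ℕ → ℝ := fun k => ∑ q ∈ Ico 1 K, L q * S y (n + k + 1 + q) ^ 3 / 2 + ξ k with hθ_def
  have hξ0 : ∀ k, 0 ≤ ξ k := fun k => by have := hpos (n + k + 1); positivity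
  have hθ0 : ∀ k, 0 ≤ θ k := fun k => by
    have h1 : 0 ≤ ∑ q ∈ Ico 1 K, L q * S y (n + k + 1 + q) ^ 3 / 2 :=
      sum_nonneg fun q _ => by have := hL q; have := hpos (n + k + 1 + q); positivity
    have h2 := hξ0 k
    simp only [hθ_def]; linarith
  have hdef : ∀ j, j + 1 < K → (1 / S' (S y (n + 1)) j ^ 2 - 1 / S y (n + 1 + j) ^ 2)
      - (1 / S' (S y (n + 1)) (j + 1) ^ 2 - 1 / S y (n + 1 + j + 1) ^ 2)
      ≤ θ (j + 1) * (1 / S' (S y (n + 1)) j ^ 2 - 1 / S y (n + 1 + j) ^ 2) := by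
    intro j _
    have h := conf_incr_ge_markov hBaff hL hmono' hβ hB' hM' hlo' hEmod hME hS huniq hS' huniq' hy hyγ (n + 1) j (hcmp (n + 1) (by omega))
      (hcmp (n + 1 + 1 + j) (by omega)) (hX (n + 1 + 1 + j) (by omega))
    rw [show n + 1 + 1 + j = n + (j + 1) + 1 by ring] at h
    exact h
  have hθle : ∀ k, 1 ≤ k → k < K → θ k ≤ ∑ q ∈ Ico 1 K, L q * S y (n + k + 1 + q) ^ 3 / 2 + ξ k := fun k _ _ => le_rfl
  have hξ : ∀ k, 1 ≤ k → k < K → ξ k ≤ β₀ / 10 * S y (n + 1) ^ 2 := by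
    intro k hk1 _
    have hx := hpos (n + k + 1)
    have hγk : S y (n + k + 1) ≤ γ := (hh _).2
    have h2k : S y (n + k + 1) ^ 2 ≤ S y (n + 1) ^ 2 := pow_le_pow_left₀ hx.le (hanti (by omega)) 2
    have h3 : (L 0 + ME) * S y (n + k + 1) ^ 3 / 2 ≤ (L 0 + ME) * γ * S y (n + k + 1) ^ 2 / 2 := by
      have : S y (n + k + 1) ^ 3 ≤ γ * S y (n + k + 1) ^ 2 := by nlinarith [pow_pos hx 2]
      nlinarith [mul_le_mul_of_nonneg_left this hLM0]
    have h4 : (L 0 + ME) * γ * S y (n + k + 1) ^ 2 / 2 ≤ β₀ / 5 * S y (n + 1) ^ 2 / 2 := by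
      have := mul_le_mul hLMγ h2k (sq_nonneg _) (by positivity)
      linarith
    simp only [hξ_def]
    linarith
  exact base_gauge_of_defect hBaff hL hβ hB' hM' hexc hDmono hS huniq hS' huniq' hy hyγ n hu hcmp hX hθ0 hξ0 hdef hθle hξ

/-! ## §2 The nonlinear level gauge along every orbit -/

/-- **THE NONLINEAR LEVEL GAUGE WITH A SMALL MARKOV RIDER.**  `B u = β₀ + Σ_{k<K} L_k·u_k` (`β₀ > 0`, `L ≥ 0`, `L_0` free); `B′ ≥ B` with modulus `M′`, isotone excess of
modulus `ME` with `(L_0 + ME)·γ ≤ β₀∕5`; unique solution families.  Along every base orbit `h = S y`: `X_m ≥ 0` and `X_{m+1}h_{m+1}² ≤ X_mh_m²` at EVERY depth `m`. [folklore] -/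
theorem steps_nonneg_gauge_markov (hBaff : ∀ u, SeqBox γ u → B u = β₀ + ∑ k ∈ range K, L k * u k) (hL : ∀ k, 0 ≤ L k) (hβ : 0 < β₀)
    (hB' : ∀ u u' : ℕ → ℝ, SeqBox γ u → SeqBox γ u' → ∀ D : ℝ, (∀ j, |u j - u' j| ≤ D) → |B' u - B' u'| ≤ M' * D) (hM' : 0 ≤ M')
    (hexc : ∀ u, SeqBox γ u → B u ≤ B' u)
    (hDmono : ∀ u v : ℕ → ℝ, SeqBox γ u → SeqBox γ v → (∀ j, u j ≤ v j) → B' u - B u ≤ B' v - B v)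
    (hEmod : ∀ u u' : ℕ → ℝ, SeqBox γ u → SeqBox γ u' → (∀ j, u' j ≤ u j) → ∀ D : ℝ, 0 ≤ D → (∀ j, u j - u' j ≤ D) →
      (B' u - B u) - (B' u' - B u') ≤ ME * D) (hME : 0 ≤ ME) (hLMγ : (L 0 + ME) * γ ≤ β₀ / 5)
    (hS : ∀ p, 0 < p → p ≤ γ → SeqBox γ (S p) ∧ MemFlow B p (S p))
    (huniq : ∀ p, 0 < p → p ≤ γ → ∀ u u' : ℕ → ℝ, SeqBox γ u → SeqBox γ u' → MemFlow B p u → MemFlow B p u' → u = u')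
    (hS' : ∀ p, 0 < p → p ≤ γ → SeqBox γ (S' p) ∧ MemFlow B' p (S' p))
    (huniq' : ∀ p, 0 < p → p ≤ γ → ∀ u u' : ℕ → ℝ, SeqBox γ u → SeqBox γ u' → MemFlow B' p u → MemFlow B' p u' → u = u')
    {y : ℝ} (hy : 0 < y) (hyγ : y ≤ γ) :
    ∀ m, 0 ≤ B' (S' (S y m)) - B (S (S y m))
      ∧ (B' (S' (S y (m + 1))) - B (S (S y (m + 1)))) * S y (m + 1) ^ 2 ≤ (B' (S' (S y m)) - B (S (S y m))) * S y m ^ 2 := by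
  obtain ⟨hmono, hlo, hdom, hBmod⟩ := affine_facts hBaff hL hβ
  have hM : 0 ≤ ∑ k ∈ range K, L k := sum_nonneg fun k _ => hL k
  have hh := (hS y hy hyγ).1
  have hf := (hS y hy hyγ).2
  have hpos : ∀ j, 0 < S y j := fun j => (hh j).1
  -- the deep region
  obtain ⟨N₀, hN₀⟩ := exists_base_depth hBaff hL hβ hh hf
  have hXdeep : ∀ m, N₀ ≤ m → 0 ≤ B' (S' (S y m)) - B (S (S y m)) := by
    intro m hm
    have hq := family_mem hS hy hyγ m
    have hsmall := (hN₀ m hm).2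
    have := effective_le_of_small_pin hBmod hM hβ hlo hexc hDmono hq.1 hq.2 hsmall (hS _ hq.1 hq.2).1 (hS _ hq.1 hq.2).2
      (hS' _ hq.1 hq.2).1 (hS' _ hq.1 hq.2).2
    linarith
  have hΔe : ∀ m, 0 ≤ ((B' (S' (S y m)) - B (S' (S y m))) - (B' (S' (S y (m + 1))) - B (S' (S y (m + 1))))) * S y m ^ 2 := fun m =>
    mul_nonneg (by linarith [(excess_orbit_antitone hBaff hL hβ hB' hM' hexc hDmono hS hS' huniq' hy hyγ m).2]) (sq_nonneg _)
  -- P(n): non-negativity and the gauge at every m ≥ n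
  have hP : ∀ d n, N₀ ≤ n + d → ∀ m, n ≤ m → 0 ≤ B' (S' (S y m)) - B (S (S y m))
      ∧ (B' (S' (S y (m + 1))) - B (S (S y (m + 1)))) * S y (m + 1) ^ 2 ≤ (B' (S' (S y m)) - B (S (S y m))) * S y m ^ 2 := by
    intro d
    induction d with
    | zero =>
      intro n hn m hm
      rw [add_zero] at hn
      refine ⟨hXdeep m (hn.trans hm), ?_⟩
      have hb := base_gauge_markov hBaff hL hβ hB' hM' hexc hDmono hEmod hME hLMγ hS huniq hS' huniq' hy hyγ m (hN₀ m (hn.trans hm)).1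
        (cmp_of_steps_nonneg hBaff hL hβ hB' hM' hexc hDmono hS huniq hS' huniq' hy hyγ m fun m' hm' => hXdeep m' (by omega))
        fun m' hm' => hXdeep m' (by omega)
      linarith [hΔe m]
    | succ d ih =>
      intro n hn m hm
      have ih' := ih (n + 1) (by omega)
      by_cases hm1 : n + 1 ≤ m
      · exact ih' m hm1
      · have hmn : m = n := by omega
        subst hmn
        have hXb : ∀ m', m + 1 ≤ m' → 0 ≤ B' (S' (S y m')) - B (S (S y m')) := fun m' hm' => (ih' m' hm').1
        have hgb : ∀ m', m + 1 ≤ m' → (B' (S' (S y (m' + 1))) - B (S (S y (m' + 1)))) * S y (m' + 1) ^ 2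
            ≤ (B' (S' (S y m')) - B (S (S y m'))) * S y m' ^ 2 := fun m' hm' => (ih' m' hm').2
        have hgs := gauge_step_markov hBaff hL hβ hB' hM' hexc hDmono hEmod hME hLMγ hS huniq hS' huniq' hy hyγ m hXb hgb
        have hG1 : 0 ≤ (B' (S' (S y (m + 1))) - B (S (S y (m + 1)))) * S y (m + 1) ^ 2 := mul_nonneg (hXb (m + 1) le_rfl) (sq_nonneg _)
        have hm2 : 0 < S y m ^ 2 := pow_pos (hpos m) 2
        refine ⟨?_, by linarith [hΔe m]⟩
        have h1 : 0 ≤ (B' (S' (S y m)) - B (S (S y m))) * S y m ^ 2 := by linarith [hΔe m]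
        nlinarith
  intro m
  exact hP N₀ 0 (by omega) m (Nat.zero_le m)

/-! ## §3 Comparison at any size with a small Markov rider -/

/-- **THE EFFECTIVE β-FUNCTIONS OF `B` AND `B′` ARE ORDERED AT EVERY PIN**, `B(S y) ≤ B′(S′y)` for every `y ∈ ]0,γ]` — affine base with Markov weight `L_0`, isotone excess
of modulus `ME`, `(L_0 + ME)·γ ≤ β₀∕5`. [folklore] -/
theorem effective_le_markov (hBaff : ∀ u, SeqBox γ u → B u = β₀ + ∑ k ∈ range K, L k * u k) (hL : ∀ k, 0 ≤ L k) (hβ : 0 < β₀)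
    (hB' : ∀ u u' : ℕ → ℝ, SeqBox γ u → SeqBox γ u' → ∀ D : ℝ, (∀ j, |u j - u' j| ≤ D) → |B' u - B' u'| ≤ M' * D) (hM' : 0 ≤ M')
    (hexc : ∀ u, SeqBox γ u → B u ≤ B' u)
    (hDmono : ∀ u v : ℕ → ℝ, SeqBox γ u → SeqBox γ v → (∀ j, u j ≤ v j) → B' u - B u ≤ B' v - B v)
    (hEmod : ∀ u u' : ℕ → ℝ, SeqBox γ u → SeqBox γ u' → (∀ j, u' j ≤ u j) → ∀ D : ℝ, 0 ≤ D → (∀ j, u j - u' j ≤ D) →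
      (B' u - B u) - (B' u' - B u') ≤ ME * D) (hME : 0 ≤ ME) (hLMγ : (L 0 + ME) * γ ≤ β₀ / 5)
    (hS : ∀ p, 0 < p → p ≤ γ → SeqBox γ (S p) ∧ MemFlow B p (S p))
    (huniq : ∀ p, 0 < p → p ≤ γ → ∀ u u' : ℕ → ℝ, SeqBox γ u → SeqBox γ u' → MemFlow B p u → MemFlow B p u' → u = u')
    (hS' : ∀ p, 0 < p → p ≤ γ → SeqBox γ (S' p) ∧ MemFlow B' p (S' p))
    (huniq' : ∀ p, 0 < p → p ≤ γ → ∀ u u' : ℕ → ℝ, SeqBox γ u → SeqBox γ u' → MemFlow B' p u → MemFlow B' p u' → u = u') :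
    ∀ y, 0 < y → y ≤ γ → B (S y) ≤ B' (S' y) := by
  intro y hy hyγ
  have := (steps_nonneg_gauge_markov hBaff hL hβ hB' hM' hexc hDmono hEmod hME hLMγ hS huniq hS' huniq' hy hyγ 0).1
  rw [family_zero hS hy hyγ] at this
  linarith

/-- **COMPARISON AT ANY SIZE WITH A SMALL MARKOV RIDER, family-free form.**  `B u = β₀ + Σ_{k<K} L_k·u_k` on the box ]0,γ] with `β₀ > 0`, `L ≥ 0` — the Markov weight
`L_0`, the profile, the range `K` and ALL SIZES ARBITRARY; `B′ ≥ B` on the box with a modulus `M′ ≥ 0`, the excess `B′ − B` ISOTONE and of modulus `ME ≥ 0` along ordered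
pairs, with `(L_0 + ME)·γ ≤ β₀∕5`; `h`, `h′` ANY box solutions of `B`, `B′` from one pin `p ∈ ]0,γ]`.  Then `h′ ≤ h` at EVERY scale — (E119d) without `L_0 = 0`. [folklore] -/
theorem le_of_small_modulus_excess_markov {p : ℝ} {h h' : ℕ → ℝ} (hBaff : ∀ u, SeqBox γ u → B u = β₀ + ∑ k ∈ range K, L k * u k) (hL : ∀ k, 0 ≤ L k)
    (hβ : 0 < β₀)
    (hB' : ∀ u u' : ℕ → ℝ, SeqBox γ u → SeqBox γ u' → ∀ D : ℝ, (∀ j, |u j - u' j| ≤ D) → |B' u - B' u'| ≤ M' * D) (hM' : 0 ≤ M')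
    (hexc : ∀ u, SeqBox γ u → B u ≤ B' u)
    (hDmono : ∀ u v : ℕ → ℝ, SeqBox γ u → SeqBox γ v → (∀ j, u j ≤ v j) → B' u - B u ≤ B' v - B v)
    (hEmod : ∀ u u' : ℕ → ℝ, SeqBox γ u → SeqBox γ u' → (∀ j, u' j ≤ u j) → ∀ D : ℝ, 0 ≤ D → (∀ j, u j - u' j ≤ D) →
      (B' u - B u) - (B' u' - B u') ≤ ME * D) (hME : 0 ≤ ME) (hLMγ : (L 0 + ME) * γ ≤ β₀ / 5)
    (hp : 0 < p) (hpγ : p ≤ γ) (hh : SeqBox γ h) (hf : MemFlow B p h) (hh' : SeqBox γ h') (hf' : MemFlow B' p h') (j : ℕ) :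
    h' j ≤ h j := by
  obtain ⟨hmono', hlo'⟩ := excess_facts hBaff hL hβ hexc hDmono
  obtain ⟨hmono, hlo, _, hBmod⟩ := affine_facts hBaff hL hβ
  have hM : 0 ≤ ∑ k ∈ range K, L k := sum_nonneg fun k _ => hL k
  have hγ : 0 < γ := hp.trans_le hpγ
  have hex : ∀ q : ℝ, 0 < q → q ≤ γ → ∃ k : ℕ → ℝ, SeqBox γ k ∧ MemFlow B q k := fun q hq hqγ => exists_memFlow_zm hBmod hM hq hqγ hβ hlo
  have hex' : ∀ q : ℝ, 0 < q → q ≤ γ → ∃ k : ℕ → ℝ, SeqBox γ k ∧ MemFlow B' q k := fun q hq hqγ => exists_memFlow_zm hB' hM' hq hqγ hβ hlo'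
  choose! S hSb hSf using hex
  choose! S' hS'b hS'f using hex'
  have hS : ∀ q, 0 < q → q ≤ γ → SeqBox γ (S q) ∧ MemFlow B q (S q) := fun q hq hqγ => ⟨hSb q hq hqγ, hSf q hq hqγ⟩
  have hS' : ∀ q, 0 < q → q ≤ γ → SeqBox γ (S' q) ∧ MemFlow B' q (S' q) := fun q hq hqγ => ⟨hS'b q hq hqγ, hS'f q hq hqγ⟩
  have huniq : ∀ q, 0 < q → q ≤ γ → ∀ u u' : ℕ → ℝ, SeqBox γ u → SeqBox γ u' → MemFlow B q u → MemFlow B q u' → u = u' :=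
    fun q hq _ u u' hu hu' hfu hfu' => memFlow_unique_of_monotone_zm hmono hBmod hM hq hβ hlo hu hu' hfu hfu'
  have huniq' : ∀ q, 0 < q → q ≤ γ → ∀ u u' : ℕ → ℝ, SeqBox γ u → SeqBox γ u' → MemFlow B' q u → MemFlow B' q u' → u = u' :=
    fun q hq _ u u' hu hu' hfu hfu' => memFlow_unique_of_monotone_zm hmono' hB' hM' hq hβ hlo' hu hu' hfu hfu'
  have e : h = S p := huniq p hp hpγ _ _ hh (hS p hp hpγ).1 hf (hS p hp hpγ).2
  have e' : h' = S' p := huniq' p hp hpγ _ _ hh' (hS' p hp hpγ).1 hf' (hS' p hp hpγ).2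
  rw [e, e']
  exact family_le_of_orbit hβ hγ hB' hM' hlo' hS huniq hS' huniq' ⟨hp, hpγ⟩ (fun i _ =>
    effective_le_markov hBaff hL hβ hB' hM' hexc hDmono hEmod hME hLMγ hS huniq hS' huniq' _ (family_mem hS hp hpγ i).1 (family_mem hS hp hpγ i).2) j

end Summit.QuantumFields.BalabanUV.Beta.EriceRemainderEnclosureHistoryAutonomyComparisonNonlinearMarkov

end
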